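import Literature.Computability.Complexity.GraphCanonizationSchemeEquiv
import Literature.Computability.Complexity.GraphCanonization
import HarnessLib

/-!
# The section/individualization canoniser is label-invariant: a canonical form of coloured graphs

Correctness of `CGCanon.canon` (`GraphCanonizationScheme.lean`), the undirected vertex-coloured
case of the Corneil–Goldberg canoniser in Laubner's form [Laubner2011, Thm. 3.4.3]
([CorneilGoldberg1984]): for every refiner `R`,

* **`CGCanon.code_canon_comap`** — LABEL-INVARIANCE of the code of the computed ordering: along a
  relabelling `e` (pullback form: `(G.comap e, W, c ∘ e)` versus `(G, W.map e, c)`, the target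
  state equitable) the two orderings have the same code. Section nodes: the sorted lists of part
  codes agree (`List.Perm.eq_of_sortedLE`) and pasting is code-determined across the
  colour-determined frontier (`code_append`); individualization nodes: corresponding branching
  vertices have corresponding refined states (`Refiner.equivariant`), equal child codes by
  induction, hence equal codes for the parent colouring (`code_eq_of_refines`), and the least
  candidates have the same code.
* **`CGCanon.cf R G col`** — the CANONICAL FORM: the coloured graph on `Fin k` read off the code of
  `(G, col)` along `canon R G univ (R.refine G univ col)`; `cf_colIso` (it is colour-isomorphic to
  `(G, col)`) and `cf_eq_of_colIso` (colour-isomorphic inputs have EQUAL canonical forms).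

With the `C^k` size bound and a refiner this is the mathematical content of the discharge of
`babaiLuks1983_canonicalForm`; the machine (an `FP` program on padded codes) is separate.

## References

* B. Laubner, PhD thesis, HU Berlin 2011, doi:10.18452/16335, Thm. 3.4.3. [Laubner2011]
* D. G. Corneil, M. K. Goldberg, J. Algorithms 5 (1984) 345–362. [CorneilGoldberg1984]
-/

namespace Literature.Computability.Complexity

open Literature.Combinatorics.SimpleGraph Finset ColourRefinementScheme

open scoped Classical

noncomputable section

namespace CGCanon

variable {k : ℕ}

/-! ### Small order-theoretic and list facts -/

/-- The first component is monotone for the lexicographic order. [folklore] -/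
theorem fst_le_of_lex_le {α β : Type} [LinearOrder α] [LinearOrder β] {a b : Lex (α × β)} (h : a ≤ b) :
    (ofLex a).1 ≤ (ofLex b).1 := by
  rcases (Prod.Lex.le_iff (x := ofLex a) (y := ofLex b)).1 h with h | ⟨h, -⟩
  · exact h.le
  · exact h.le

/-- Least elements of two finsets of lexicographic products with the same first components have
the same first component. [folklore] -/
theorem fst_min'_eq {α β γ : Type} [LinearOrder α] [LinearOrder β] [LinearOrder γ]
    {S : Finset (Lex (α × β))} {T : Finset (Lex (α × γ))} (hS : S.Nonempty) (hT : T.Nonempty)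
    (h₁ : ∀ s ∈ S, ∃ t ∈ T, (ofLex t).1 = (ofLex s).1) (h₂ : ∀ t ∈ T, ∃ s ∈ S, (ofLex s).1 = (ofLex t).1) :
    (ofLex (S.min' hS)).1 = (ofLex (T.min' hT)).1 := by
  apply le_antisymm
  · obtain ⟨s, hs, hse⟩ := h₂ _ (T.min'_mem hT)
    rw [← hse]
    exact fst_le_of_lex_le (S.min'_le s hs)
  · obtain ⟨t, ht, hte⟩ := h₁ _ (S.min'_mem hS)
    rw [← hte]
    exact fst_le_of_lex_le (T.min'_le t ht)

/-- The list of an image finset is a permutation of the mapped list (injective map). [folklore] -/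
theorem toList_image_perm {α β : Type} [DecidableEq β] (s : Finset α) {f : α → β} (hf : Function.Injective f) :
    (s.image f).toList.Perm (s.toList.map f) := by
  apply Multiset.coe_eq_coe.1
  rw [coe_toList, ← Multiset.map_coe, coe_toList, image_val_of_injOn (hf.injOn)]

/-- A list which is pairwise `≤` on first components of keys, read through a key-monotone map,
is `SortedLE`. [folklore] -/
theorem sortedLE_map_of_pairwise {α β : Type} [LinearOrder β] {l : List α} {key : α → β} (h : l.Pairwise fun a b => key a ≤ key b) :
    (l.map key).SortedLE := by
  rw [List.sortedLE_iff_pairwise, List.pairwise_map]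
  exact h

/-! ### From child codes to parent codes -/

/-- **Equal codes for refined colourings give equal codes for the coarser ones**: if the codes of
`ord₁` (pulled-back state, colouring `c₁`) and `ord₂` (colouring `c₂`) agree, `c₁` corresponds to
`c₂` along `e` on `W`, `c₁` refines `c'` on `W`, and `c'` corresponds to `c` along `e` on `W`, then
the codes for `c'` and `c` agree. [folklore] -/
theorem code_eq_of_refines {G : SimpleGraph (Fin k)} {e : Equiv.Perm (Fin k)} {W : Finset (Fin k)}
    {c c' c₁ c₂ : Fin k → ℕ} (hc : ∀ v ∈ W, c' v = c (e v)) (hc₁ : ∀ v ∈ W, c₁ v = c₂ (e v))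
    (href : ∀ ⦃u v : Fin k⦄, u ∈ W → v ∈ W → c₁ u = c₁ v → c' u = c' v)
    {ord₁ ord₂ : List (Fin k)} (h₁ : ∀ v ∈ ord₁, v ∈ W) (h₂ : ∀ v ∈ ord₂, v ∈ W.map e.toEmbedding)
    (h : code (G.comap e) c₁ ord₁ = code G c₂ ord₂) : code (G.comap e) c' ord₁ = code G c ord₂ := by
  unfold code at h ⊢
  have h' := Prod.ext_iff.1 (toLex.injective h)
  simp only at h'
  congr 1
  refine Prod.ext h'.1 ?_
  have hlen : ord₁.length = ord₂.length := by simpa using congrArg List.length h'.2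
  apply List.ext_getElem (by simpa using hlen)
  intro i hi₁ hi₂
  rw [List.length_map] at hi₁ hi₂
  have key : c₁ (ord₁[i]) = c₂ (ord₂[i]) := by
    have := congrArg (fun l => l[i]?) h'.2
    simpa [List.getElem?_map, hi₁, hi₂] using this
  simp only [List.getElem_map]
  have hv₁ : ord₁[i] ∈ W := h₁ _ (List.getElem_mem hi₁)
  have hv₂ : e.symm (ord₂[i]) ∈ W := (mem_map_perm_iff_symm e W _).1 (h₂ _ (List.getElem_mem hi₂))
  rw [← e.apply_symm_apply (ord₂[i]), ← hc _ hv₂]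
  refine href hv₁ hv₂ ?_
  rw [key, hc₁ _ hv₂, Equiv.apply_symm_apply]

/-! ### Label-invariance of the code of the canoniser -/

variable (R : Refiner k) (G : SimpleGraph (Fin k)) (e : Equiv.Perm (Fin k))

/-- The switch-bit function on colours used for pasting. [folklore] -/
def swFun (G : SimpleGraph (Fin k)) (W : Finset (Fin k)) (c : Fin k → ℕ) (a b : ℕ) : Bool :=
  decide (Switch (within G W) (liftCol W c) (a + 1) (b + 1))

variable {R G e}

/-- Across two different parts adjacency is the switch bit of the colours. [cite: Laubner2011, Prop. 3.3.4] -/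
theorem decide_adj_eq_swFun {W : Finset (Fin k)} {c : Fin k → ℕ} {K K' : Finset (Fin k)} (hK : K ∈ parts G W c) (hK' : K' ∈ parts G W c)
    (hne : K ≠ K') {u v : Fin k} (hu : u ∈ K) (hv : v ∈ K') : decide (G.Adj u v) = swFun G W c (c u) (c v) := by
  obtain ⟨a, -, rfl⟩ := mem_image.1 hK
  obtain ⟨b, -, rfl⟩ := mem_image.1 hK'
  have huW : u ∈ W := comp_subset a hu
  have hvW : v ∈ W := comp_subset b hv
  have hcu : comp G W c u = comp G W c a := comp_eq_of_mem hu
  have hcv : comp G W c v = comp G W c b := comp_eq_of_mem hv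
  have hnr : ¬ (swG G W c).Reachable u v := fun h => hne (by
    rw [← hcu, ← hcv]; exact (comp_eq_of_mem (mem_comp.2 ⟨hvW, h⟩)).symm)
  have hne' : u ≠ v := fun h => hnr (h ▸ SimpleGraph.Reachable.refl _)
  have key := adj_iff_switch_of_not_adj huW hvW hne' fun h => hnr h.reachable
  rw [liftCol_of_mem c huW, liftCol_of_mem c hvW] at key
  simp only [swFun, key]

/-- Pasting, in parallel: lists of distinct parts of the two states with the same sequence of
part codes paste to the same code. [cite: Laubner2011, Thm. 3.4.3] -/
theorem code_flatMap_eq {W : Finset (Fin k)} {c c' : Fin k → ℕ} (hc : ∀ v ∈ W, c' v = c (e v))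
    {ordOf₁ ordOf₂ : Finset (Fin k) → List (Fin k)}
    (hm₁ : ∀ K ∈ parts (G.comap e) W c', ∀ v, v ∈ ordOf₁ K ↔ v ∈ K)
    (hm₂ : ∀ K ∈ parts G (W.map e.toEmbedding) c, ∀ v, v ∈ ordOf₂ K ↔ v ∈ K) :
    ∀ (L₁ L₂ : List (Finset (Fin k))), (∀ K ∈ L₁, K ∈ parts (G.comap e) W c') → (∀ K ∈ L₂, K ∈ parts G (W.map e.toEmbedding) c) →
      L₁.Nodup → L₂.Nodup →
      L₁.map (fun K => code (G.comap e) c' (ordOf₁ K)) = L₂.map (fun K => code G c (ordOf₂ K)) →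
      code (G.comap e) c' (L₁.flatMap ordOf₁) = code G c (L₂.flatMap ordOf₂)
  | [], [], _, _, _, _, _ => rfl
  | [], _ :: _, _, _, _, _, h => by simp at h
  | _ :: _, [], _, _, _, _, h => by simp at h
  | K₁ :: M₁, K₂ :: M₂, hP₁, hP₂, hn₁, hn₂, h => by
    rw [List.map_cons, List.map_cons, List.cons.injEq] at h
    rw [List.nodup_cons] at hn₁ hn₂
    have hK₁ := hP₁ K₁ List.mem_cons_self
    have hK₂ := hP₂ K₂ List.mem_cons_self
    have x₁ : ∀ u ∈ ordOf₁ K₁, ∀ v ∈ M₁.flatMap ordOf₁,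
        decide ((G.comap e).Adj u v) = swFun (G.comap e) W c' (c' u) (c' v) := by
      intro u hu v hv
      obtain ⟨K', hK', hv'⟩ := List.mem_flatMap.1 hv
      have hK'P := hP₁ K' (List.mem_cons_of_mem _ hK')
      exact decide_adj_eq_swFun hK₁ hK'P (fun h => hn₁.1 (h ▸ hK')) ((hm₁ K₁ hK₁ u).1 hu) ((hm₁ K' hK'P v).1 hv')
    have x₂ : ∀ u ∈ ordOf₂ K₂, ∀ v ∈ M₂.flatMap ordOf₂,
        decide (G.Adj u v) = swFun G (W.map e.toEmbedding) c (c u) (c v) := by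
      intro u hu v hv
      obtain ⟨K', hK', hv'⟩ := List.mem_flatMap.1 hv
      have hK'P := hP₂ K' (List.mem_cons_of_mem _ hK')
      exact decide_adj_eq_swFun hK₂ hK'P (fun h => hn₂.1 (h ▸ hK')) ((hm₂ K₂ hK₂ u).1 hu) ((hm₂ K' hK'P v).1 hv')
    have hS : swFun (G.comap e) W c' = swFun G (W.map e.toEmbedding) c := by
      funext a b; simp only [swFun, switch_comap_iff' hc]
    rw [List.flatMap_cons, List.flatMap_cons, code_append _ x₁, code_append _ x₂, h.1, hS,
      code_flatMap_eq hc hm₁ hm₂ M₁ M₂ (fun K hK => hP₁ K (List.mem_cons_of_mem _ hK))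
        (fun K hK => hP₂ K (List.mem_cons_of_mem _ hK)) hn₁.2 hn₂.2 h.2]

/-- **Label-invariance of the canoniser's code** (pullback form): if `c' = c ∘ e` on `W` and the
state `(W.map e, c)` of `G` is equitable, the ordering computed in the pulled-back state
`(G.comap e, W, c')` and the one computed in `(G, W.map e, c)` have the same code. [cite: Laubner2011, Thm. 3.4.3] -/
theorem code_canon_comap (R : Refiner k) (G : SimpleGraph (Fin k)) (e : Equiv.Perm (Fin k)) (W : Finset (Fin k)) (c c' : Fin k → ℕ)
    (hc : ∀ v ∈ W, c' v = c (e v)) (hE : IsEqui G (W.map e.toEmbedding) c) :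
    code (G.comap e) c' (canon R (G.comap e) W c') = code G c (canon R G (W.map e.toEmbedding) c) := by
  suffices H : ∀ (n m : ℕ) (W : Finset (Fin k)) (c c' : Fin k → ℕ), W.card = n → W.card - (W.image c').card = m →
      (∀ v ∈ W, c' v = c (e v)) → IsEqui G (W.map e.toEmbedding) c →
      code (G.comap e) c' (canon R (G.comap e) W c') = code G c (canon R G (W.map e.toEmbedding) c) from
    H _ _ W c c' rfl rfl hc hE
  intro n
  induction n using Nat.strong_induction_on with
  | _ n ihn =>
  intro m
  induction m using Nat.strong_induction_on with
  | _ m ihm =>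
  intro W c c' hn hm hc hE
  have hcard : (W.map e.toEmbedding).card = W.card := card_map _
  by_cases hW : W.card ≤ 1
  · -- trivial states
    rw [canon_of_card_le_one hW, canon_of_card_le_one (hcard.symm ▸ hW)]
    rcases Nat.le_one_iff_eq_zero_or_eq_one.1 hW with h0 | h1
    · obtain rfl : W = ∅ := card_eq_zero.1 h0
      rw [map_empty, sort_empty]
      rfl
    · obtain ⟨v, rfl⟩ := card_eq_one.1 h1
      rw [map_singleton, sort_singleton, sort_singleton, code_comap (c := c) (fun w hw => ?_)]
      · rfl
      · rw [List.mem_singleton.1 hw]; exact hc v (mem_singleton_self v)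
  by_cases hconn : IsConn (G.comap e) W c'
  · -- individualization node
    have hconn₂ : IsConn G (W.map e.toEmbedding) c := (isConn_comap_iff hc).1 hconn
    have hW₂ : ¬ (W.map e.toEmbedding).card ≤ 1 := hcard.symm ▸ hW
    have hA₂ : (bigMinCell (W.map e.toEmbedding) c).Nonempty := by
      obtain ⟨u, hu⟩ : (W.map e.toEmbedding).Nonempty := card_pos.1 (by omega)
      exact bigMinCell_nonempty ⟨u, hu, hE.two_le_card_cell hconn₂ (by omega) hu⟩
    have hA₁ : (bigMinCell W c').Nonempty := by
      rw [← map_nonempty (f := e.toEmbedding), bigMinCell_comap hc]; exact hA₂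
    rw [canon_of_isConn hW hconn hA₁, canon_of_isConn hW₂ hconn₂ hA₂]
    set S₁ := (bigMinCell W c').attach.image fun x => cand R (G.comap e) W c' x.1 with hS₁
    set S₂ := (bigMinCell (W.map e.toEmbedding) c).attach.image fun x => cand R G (W.map e.toEmbedding) c x.1 with hS₂
    have hne₁ : S₁.Nonempty := (attach_nonempty_iff.2 hA₁).image _
    have hne₂ : S₂.Nonempty := (attach_nonempty_iff.2 hA₂).image _
    -- the code of the least candidate is its first component
    have e₁ : code (G.comap e) c' (ofLex (ofLex (S₁.min' hne₁)).2).2 = (ofLex (S₁.min' hne₁)).1 := by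
      obtain ⟨x, -, hx⟩ := mem_image.1 (S₁.min'_mem hne₁)
      rw [← hx]; rfl
    have e₂ : code G c (ofLex (ofLex (S₂.min' hne₂)).2).2 = (ofLex (S₂.min' hne₂)).1 := by
      obtain ⟨x, -, hx⟩ := mem_image.1 (S₂.min'_mem hne₂)
      rw [← hx]; rfl
    rw [e₁, e₂]
    have child : ∀ x ∈ bigMinCell W c', code (G.comap e) c' (canon R (G.comap e) W (R.refine (G.comap e) W (individualize c' x))) =
        code G c (canon R G (W.map e.toEmbedding) (R.refine G (W.map e.toEmbedding) (individualize c (e x)))) := by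
      intro x hx
      set c₁ := R.refine (G.comap e) W (individualize c' x) with hc₁d
      set c₂ := R.refine G (W.map e.toEmbedding) (individualize c (e x)) with hc₂d
      have hc₁ : ∀ v ∈ W, c₁ v = c₂ (e v) := R.equivariant G e W (individualize c (e x)) (individualize c' x) (individualize_comap hc x)
      have hlt : W.card - (W.image c₁).card < m := hm ▸ measure_lt_of_mem_bigMinCell R (G.comap e) W c' hx
      have ih := ihm _ hlt W c₂ c₁ hn rfl hc₁ (R.isEqui G _ _)
      refine code_eq_of_refines hc hc₁ (fun u v hu hv huv => ?_) (fun v hv => (mem_canon_iff R _ W c₁ v).1 hv)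
        (fun v hv => (mem_canon_iff R G _ c₂ v).1 hv) ih
      have := R.refines (G.comap e) W (individualize c' x) hu hv huv
      simp only [individualize] at this
      obtain ⟨hxW, -⟩ := mem_bigMinCell.1 hx
      by_cases hux : u = x
      · by_cases hvx : v = x
        · rw [hux, hvx]
        · rw [if_pos hux, if_neg hvx] at this; exact absurd this (by omega)
      · by_cases hvx : v = x
        · rw [if_neg hux, if_pos hvx] at this; exact absurd this (by omega)
        · rw [if_neg hux, if_neg hvx] at this; exact Nat.succ_injective this
    refine fst_min'_eq hne₁ hne₂ (fun s hs => ?_) (fun t ht => ?_)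
    · rw [hS₁, mem_image] at hs
      obtain ⟨⟨x, hx⟩, -, rfl⟩ := hs
      refine ⟨cand R G (W.map e.toEmbedding) c (e x), ?_, (child x hx).symm⟩
      rw [hS₂, mem_image]
      exact ⟨⟨e x, (mem_bigMinCell_comap_iff hc x).1 hx⟩, mem_attach _ _, rfl⟩
    · rw [hS₂, mem_image] at ht
      obtain ⟨⟨y, hy⟩, -, rfl⟩ := ht
      have hy' : e.symm y ∈ bigMinCell W c' := (mem_bigMinCell_comap_iff hc _).2 (by simpa using hy)
      refine ⟨cand R (G.comap e) W c' (e.symm y), ?_, ?_⟩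
      · rw [hS₁, mem_image]
        exact ⟨⟨e.symm y, hy'⟩, mem_attach _ _, rfl⟩
      · have := child _ hy'
        rw [Equiv.apply_symm_apply] at this
        exact this
  · -- section node
    have hconn₂ : ¬ IsConn G (W.map e.toEmbedding) c := fun h => hconn ((isConn_comap_iff hc).2 h)
    have hW₂ : ¬ (W.map e.toEmbedding).card ≤ 1 := hcard.symm ▸ hW
    rw [canon_of_not_isConn hW hconn, canon_of_not_isConn hW₂ hconn₂]
    unfold paste
    set ordOf₁ : Finset (Fin k) → List (Fin k) := fun K => if K ∈ parts (G.comap e) W c' then canon R (G.comap e) K c' else []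
    set ordOf₂ : Finset (Fin k) → List (Fin k) := fun K =>
      if K ∈ parts G (W.map e.toEmbedding) c then canon R G K c else []
    set L₁ := (parts (G.comap e) W c').toList.insertionSort fun K K' => partKey (G.comap e) c' ordOf₁ K ≤ partKey (G.comap e) c' ordOf₁ K'
    set L₂ := (parts G (W.map e.toEmbedding) c).toList.insertionSort fun K K' => partKey G c ordOf₂ K ≤ partKey G c ordOf₂ K'
    have hL₁ : L₁.Perm (parts (G.comap e) W c').toList := List.perm_insertionSort _ _
    have hL₂ : L₂.Perm (parts G (W.map e.toEmbedding) c).toList := List.perm_insertionSort _ _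
    -- codes of corresponding parts agree (induction on `|W|`)
    have part : ∀ K ∈ parts (G.comap e) W c', code (G.comap e) c' (ordOf₁ K) = code G c (ordOf₂ (K.map e.toEmbedding)) := by
      intro K hK
      have hK₂ := map_mem_parts hc hK
      simp only [ordOf₁, ordOf₂, if_pos hK, if_pos hK₂]
      have hKW : K ⊆ W := subset_of_mem_parts hK
      obtain ⟨u, hu, hKu⟩ := mem_image.1 hK₂
      have hEK : IsEqui G (K.map e.toEmbedding) c := by rw [← hKu]; exact hE.of_closed (comp_closed u)
      exact ihn K.card (hn ▸ card_lt_of_mem_parts hconn hK) _ K c c' rfl rfl (fun v hv => hc v (hKW hv)) hEK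
    refine code_flatMap_eq hc (fun K hK v => ?_) (fun K hK v => ?_) L₁ L₂ (fun K hK => mem_toList.1 (hL₁.mem_iff.1 hK))
      (fun K hK => mem_toList.1 (hL₂.mem_iff.1 hK)) (hL₁.nodup_iff.2 (nodup_toList _)) (hL₂.nodup_iff.2 (nodup_toList _)) ?_
    · simp only [ordOf₁, if_pos hK, mem_canon_iff]
    · simp only [ordOf₂, if_pos hK, mem_canon_iff]
    -- the two sorted lists of part codes coincide
    have srt₁ : L₁.Pairwise fun a b => code (G.comap e) c' (ordOf₁ a) ≤ code (G.comap e) c' (ordOf₁ b) :=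
      (List.pairwise_insertionSort _ _).imp fun {a b} (h : partKey (G.comap e) c' ordOf₁ a ≤ partKey (G.comap e) c' ordOf₁ b) =>
        fst_le_of_lex_le h
    have srt₂ : L₂.Pairwise fun a b => code G c (ordOf₂ a) ≤ code G c (ordOf₂ b) :=
      (List.pairwise_insertionSort _ _).imp fun {a b} (h : partKey G c ordOf₂ a ≤ partKey G c ordOf₂ b) => fst_le_of_lex_le h
    refine List.Perm.eq_of_sortedLE (sortedLE_map_of_pairwise srt₁) (sortedLE_map_of_pairwise srt₂) ?_
    have p₁ : (L₁.map fun K => code (G.comap e) c' (ordOf₁ K)).Perm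
        ((parts (G.comap e) W c').toList.map fun K => code (G.comap e) c' (ordOf₁ K)) := hL₁.map _
    have p₂ : ((parts (G.comap e) W c').toList.map fun K => code (G.comap e) c' (ordOf₁ K)) =
        ((parts (G.comap e) W c').toList.map fun K => K.map e.toEmbedding).map fun K => code G c (ordOf₂ K) := by
      rw [List.map_map]
      exact List.map_congr_left fun K hK => part K (mem_toList.1 hK)
    have p₃ : ((parts (G.comap e) W c').toList.map fun K => K.map e.toEmbedding).Perm (parts G (W.map e.toEmbedding) c).toList := by
      rw [← parts_comap hc]
      exact (toList_image_perm _ (map_injective e.toEmbedding)).symm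
    have p₄ : ((parts G (W.map e.toEmbedding) c).toList.map fun K => code G c (ordOf₂ K)).Perm
        (L₂.map fun K => code G c (ordOf₂ K)) := (hL₂.map _).symm
    exact p₁.trans (p₂ ▸ (p₃.map _).trans p₄)

/-! ### The canonical form -/

variable (R : Refiner k) (G : SimpleGraph (Fin k)) (col : Fin k → ℕ)

/-- The canonical ORDERING of `(G, col)`: refine the input colouring, then run the canoniser on
the whole vertex set. [cite: Laubner2011, §3.4] -/
def canonOrd : List (Fin k) := canon R G univ (R.refine G univ col)

/-- The code of `(G, col)` along its canonical ordering (colours of the INPUT colouring). [cite: Laubner2011, Thm. 3.4.3] -/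
def canonCode : Code := code G col (canonOrd R G col)

/-- **The canonical form** `cf R G col = (G', col')`: vertex `i` of `G'` stands for the `i`-th
vertex of the canonical ordering; adjacency and colours are read off the canonical code. [cite: Laubner2011, Thm. 3.4.3] -/
def cf : SimpleGraph (Fin k) × (Fin k → ℕ) :=
  (SimpleGraph.fromRel fun i j : Fin k => (((ofLex (canonCode R G col)).1.getD i.val []).getD j.val false) = true,
    fun i => ((ofLex (canonCode R G col)).2.getD i.val 0))

variable {R G col}

/-- The canonical ordering lists every vertex exactly once. [folklore] -/
theorem canonOrd_perm : (canonOrd R G col).Perm (univ.sort (· ≤ ·)) := canon_perm_sort R G _ _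

/-- The canonical ordering has length `k`. [folklore] -/
theorem length_canonOrd : (canonOrd R G col).length = k := by
  rw [canonOrd_perm.length_eq, length_sort, card_univ, Fintype.card_fin]

/-- Reading the canonical code: adjacency entry `(i, j)`. [folklore] -/
theorem canonCode_adj_getD {i j : ℕ} (hi : i < k) (hj : j < k) :
    ((ofLex (canonCode R G col)).1.getD i []).getD j false =
      decide (G.Adj ((canonOrd R G col)[i]'(length_canonOrd.symm ▸ hi)) ((canonOrd R G col)[j]'(length_canonOrd.symm ▸ hj))) := by
  have hi' : i < (canonOrd R G col).length := length_canonOrd.symm ▸ hi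
  have hj' : j < (canonOrd R G col).length := length_canonOrd.symm ▸ hj
  simp only [canonCode, code, ofLex_toLex, List.getD_eq_getElem?_getD, List.getElem?_map, List.getElem?_eq_getElem hi',
    Option.map_some, Option.getD_some, List.getElem?_eq_getElem hj']

/-- Reading the canonical code: colour entry `i`. [folklore] -/
theorem canonCode_col_getD {i : ℕ} (hi : i < k) :
    (ofLex (canonCode R G col)).2.getD i 0 = col ((canonOrd R G col)[i]'(length_canonOrd.symm ▸ hi)) := by
  have hi' : i < (canonOrd R G col).length := length_canonOrd.symm ▸ hi
  simp only [canonCode, code, ofLex_toLex, List.getD_eq_getElem?_getD, List.getElem?_map, List.getElem?_eq_getElem hi',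
    Option.map_some, Option.getD_some]

/-- The relabelling behind the canonical form: position `i ↦` the `i`-th vertex of the canonical
ordering, as a permutation of `Fin k`. [folklore] -/
def canonPerm (R : Refiner k) (G : SimpleGraph (Fin k)) (col : Fin k → ℕ) : Equiv.Perm (Fin k) :=
  (finCongr length_canonOrd.symm).trans
    ((nodup_canon R G univ (R.refine G univ col)).1.getEquivOfForallMemList _ fun v =>
      (mem_canon_iff R G univ _ v).2 (mem_univ v))

/-- `canonPerm i` is the `i`-th vertex of the canonical ordering. [folklore] -/
theorem canonPerm_apply (i : Fin k) : canonPerm R G col i = (canonOrd R G col)[i.val]'(length_canonOrd.symm ▸ i.isLt) := rfl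

/-- **The canonical form is colour-isomorphic to the input.** [cite: Laubner2011, Thm. 3.4.3] -/
theorem cf_colIso : ColIso k G col (cf R G col).1 (cf R G col).2 := by
  refine ⟨⟨(canonPerm R G col).symm, ?_⟩, fun v => ?_⟩
  · intro a b
    simp only [cf, SimpleGraph.fromRel_adj, ne_eq]
    rw [canonCode_adj_getD ((canonPerm R G col).symm a).isLt ((canonPerm R G col).symm b).isLt,
      canonCode_adj_getD ((canonPerm R G col).symm b).isLt ((canonPerm R G col).symm a).isLt,
      ← canonPerm_apply, ← canonPerm_apply, Equiv.apply_symm_apply, Equiv.apply_symm_apply, decide_eq_true_iff,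
      decide_eq_true_iff, (canonPerm R G col).symm.injective.eq_iff, G.adj_comm b a, or_self]
    exact ⟨fun h => h.2, fun h => ⟨G.ne_of_adj h, h⟩⟩
  · change (ofLex (canonCode R G col)).2.getD ((canonPerm R G col).symm v).val 0 = col v
    rw [canonCode_col_getD ((canonPerm R G col).symm v).isLt, ← canonPerm_apply, Equiv.apply_symm_apply]

/-- **Colour-isomorphic coloured graphs have the same canonical code.** [cite: Laubner2011, Thm. 3.4.3] -/
theorem canonCode_eq_of_colIso {G₁ G₂ : SimpleGraph (Fin k)} {c₁ c₂ : Fin k → ℕ} (h : ColIso k G₁ c₁ G₂ c₂) :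
    canonCode R G₁ c₁ = canonCode R G₂ c₂ := by
  obtain ⟨σ, hσ⟩ := h
  -- pull `G₂` back along `e := σ`: then `G₁ = G₂.comap e` and `c₁ = c₂ ∘ e`
  set e : Equiv.Perm (Fin k) := σ.toEquiv with he
  have hG : G₁ = G₂.comap e := by
    ext a b; rw [SimpleGraph.comap_adj]; exact (σ.map_rel_iff).symm
  have hcol : ∀ v ∈ (univ : Finset (Fin k)), c₁ v = c₂ (e v) := fun v _ => (hσ v).symm
  clear_value e
  subst hG
  unfold canonCode canonOrd
  have huniv : (univ : Finset (Fin k)).map e.toEmbedding = univ := map_univ_equiv e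
  -- the refined root colourings correspond along `e`
  have hc₀ : ∀ v ∈ (univ : Finset (Fin k)), R.refine (G₂.comap e) univ c₁ v = R.refine G₂ univ c₂ (e v) := by
    intro v hv
    rw [R.equivariant G₂ e univ c₂ c₁ hcol v hv, huniv]
  have main := code_canon_comap R G₂ e univ (R.refine G₂ univ c₂) (R.refine (G₂.comap e) univ c₁) hc₀
    (huniv.symm ▸ R.isEqui G₂ univ c₂)
  rw [huniv] at main
  exact code_eq_of_refines (W := univ) hcol hc₀ (fun u v hu hv huv => R.refines (G₂.comap e) univ c₁ hu hv huv)
    (fun v _ => mem_univ v) (fun v _ => by rw [huniv]; exact mem_univ v) main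

/-- **Colour-isomorphic coloured graphs have EQUAL canonical forms** — `cf R` is a canonical form
(with `cf_colIso`: a complete invariant realised by an isomorphic copy). [cite: Laubner2011, Thm. 3.4.3] -/
theorem cf_eq_of_colIso {G₁ G₂ : SimpleGraph (Fin k)} {c₁ c₂ : Fin k → ℕ} (h : ColIso k G₁ c₁ G₂ c₂) :
    cf R G₁ c₁ = cf R G₂ c₂ := by
  unfold cf; rw [canonCode_eq_of_colIso h]

end CGCanon

end

end Literature.Computability.Complexity
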